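import Literature.Analysis.Calculus.ConePoincareHomotopyBanach
import Literature.Analysis.FunctionSpaces.SmoothParametricIntegralWithin
import HarnessLib

/-!
# Parametric interval integrals smooth WITHIN a locally convex parameter set (Dieudonné (8.11.2), one-sided)

Topic `Analysis/Calculus`.  Everything here is proved; no named facts, one explicit construction
(`partialFDerivWithinFst`).  The "within a set" companion of
`Literature/Analysis/Calculus/ConePoincareHomotopyBanach.lean` (there the integrand is `Cⁿ` on an
OPEN set `Ω ⊇ V × [a, b]`): here the parameter `x` ranges over a set `S ⊆ E` which is only
*locally convex* (`∀ x ∈ S, ∃ ε > 0, Convex ℝ (S ∩ B(x, ε))` — e.g. `S = O ∩ K` with `O` open and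
`K` convex, such as the target `I.symm ⁻¹' U ∩ range I` of an extended chart of a manifold with
corners) and of unique differentiability, and the integrand `(x, t) ↦ H x t` is `Cⁿ` on `S × ℝ` in
Mathlib's within-a-set sense (`ContDiffOn`, one-sided derivatives at the boundary).  Then
`x ↦ ∫ₐᵇ H x t dt` is `Cⁿ` ON `S` (`contDiffOn_intervalIntegral_within`), with derivative within `S`
the integral of the partial derivative within `S × ℝ` (`hasFDerivWithinAt_intervalIntegral_within`) —
Dieudonné's (8.11.2) "one may differentiate under the integral sign", whose proof (mean value
inequality for the difference quotients on a convex neighbourhood, uniform continuity of `∂ₓH` on the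
compact `{x₀} × [a, b]`) is one-sided verbatim; the one-derivative step is the tree's
`Literature.Analysis.FunctionSpaces.hasFDerivWithinAt_integral_of_dominated_of_fderivWithin_le`
(Folland, Thm. 2.27(b), within a convex set), the domination being the constant bound of
`exists_nhdsWithin_prod_uIcc_bound_of_continuousOn` (generalized tube lemma, within `S`).
Consumer: the cylinder homotopy operator on manifolds WITH boundary or corners
(`CylinderHomotopyOperatorWithin.lean`, charts with targets open only within `range I`).

## References

* J. Dieudonné, *Foundations of Modern Analysis* (1960), (8.11.2) (differentiation under the
  integral sign, Banach-space valued, parameter in a normed space). [Dieudonne1960]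
* G. B. Folland, *Real Analysis*, 2nd ed. (1999), Thm. 2.27. [Folland1999]
-/

noncomputable section

open Set MeasureTheory intervalIntegral Filter Topology Function Metric
open scoped Interval

namespace Literature.Analysis.Calculus

universe u v

/-! ### A uniform bound near a compact parameter segment, within a set -/

section LocalBound

variable {X : Type*} [TopologicalSpace X] {G : Type*} [SeminormedAddCommGroup G]

/-- **Local bound about `{x₀} × [a, b]`, within `S`**: a function continuous on `S × ℝ` is bounded
on `s × [a, b]` for some neighbourhood `s` of `x₀` within `S` (the tree's
`exists_nhds_prod_uIcc_subset_of_continuousOn` on the subspace `S`). [cite: Dieudonne1960, (8.11.2)] -/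
theorem exists_nhdsWithin_prod_uIcc_bound_of_continuousOn {g : X × ℝ → G} {S : Set X}
    (hg : ContinuousOn g (S ×ˢ (univ : Set ℝ))) {x₀ : X} (hx₀ : x₀ ∈ S) (a b : ℝ) :
    ∃ C : ℝ, ∃ s ∈ 𝓝[S] x₀, ∀ x ∈ s, ∀ t ∈ uIcc a b, ‖g (x, t)‖ ≤ C := by
  have hc : Continuous fun p : S × ℝ => g ((p.1 : X), p.2) :=
    hg.comp_continuous ((continuous_subtype_val.comp continuous_fst).prodMk continuous_snd)
      fun p => ⟨p.1.2, mem_univ _⟩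
  obtain ⟨C, s, hs, -, hC⟩ := exists_nhds_prod_uIcc_subset_of_continuousOn (Ω := univ)
    isOpen_univ hc.continuousOn (x₀ := (⟨x₀, hx₀⟩ : S)) (a := a) (b := b) (subset_univ _)
  refine ⟨C, Subtype.val '' s, ?_, ?_⟩
  · rw [nhdsWithin_eq_map_subtype_coe hx₀]
    exact image_mem_map hs
  · rintro x ⟨p, hp, rfl⟩ t ht
    exact hC p hp t ht

end LocalBound

/-! ### Continuity and one derivative under the integral sign, within `S` -/

section Parametric

variable {E : Type u} [NormedAddCommGroup E] [NormedSpace ℝ E]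
  {G : Type*} [NormedAddCommGroup G] [NormedSpace ℝ G]
  {S : Set E} {H : E → ℝ → G} {a b : ℝ}

variable (S H) in
/-- The partial derivative in the parameter, WITHIN `S × ℝ`: `∂ₓH (x, t) = D(uncurry H)|_{S × ℝ}(x, t) ∘ (v ↦ (v, 0))`.
[cite: Dieudonne1960, (8.11.2)] -/
def partialFDerivWithinFst (x : E) (t : ℝ) : E →L[ℝ] G :=
  (fderivWithin ℝ (uncurry H) (S ×ˢ (univ : Set ℝ)) (x, t)).comp (ContinuousLinearMap.inl ℝ E ℝ)

/-- Unfolding `partialFDerivWithinFst`. [cite: Dieudonne1960, (8.11.2)] -/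
@[simp]
theorem partialFDerivWithinFst_apply (x : E) (t : ℝ) (v : E) :
    partialFDerivWithinFst S H x t v =
      fderivWithin ℝ (uncurry H) (S ×ˢ (univ : Set ℝ)) (x, t) (v, 0) :=
  rfl

omit [NormedSpace ℝ E] [NormedSpace ℝ G] in
/-- The sections `t ↦ H x t`, `x ∈ S`, of a function continuous on `S × ℝ` are continuous.
[cite: Dieudonne1960, (8.11.2)] -/
theorem continuous_section_of_continuousOn_prod_univ (hH : ContinuousOn (uncurry H) (S ×ˢ univ))
    {x : E} (hx : x ∈ S) : Continuous (H x) :=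
  hH.comp_continuous (Continuous.prodMk_right x) fun t => ⟨hx, mem_univ t⟩

omit [NormedSpace ℝ E] in
/-- **Continuity within `S` of a parametric integral** whose integrand is continuous on `S × ℝ`
(dominated convergence with the constant bound of
`exists_nhdsWithin_prod_uIcc_bound_of_continuousOn`). [cite: Dieudonne1960, (8.11.2)] -/
theorem continuousOn_intervalIntegral_within (hH : ContinuousOn (uncurry H) (S ×ˢ univ)) :
    ContinuousOn (fun x => ∫ t in a..b, H x t) S := by
  intro x₀ hx₀
  obtain ⟨C, s, hs, hC⟩ := exists_nhdsWithin_prod_uIcc_bound_of_continuousOn hH hx₀ a b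
  refine intervalIntegral.continuousWithinAt_of_dominated_interval (μ := volume)
    (bound := fun _ => C) ?_ ?_ intervalIntegrable_const ?_
  · filter_upwards [self_mem_nhdsWithin] with x hx
    exact (continuous_section_of_continuousOn_prod_univ hH hx).aestronglyMeasurable
  · filter_upwards [hs] with x hx
    exact Eventually.of_forall fun t ht => hC x hx t (uIoc_subset_uIcc ht)
  · refine Eventually.of_forall fun t _ => ?_
    have h2 : ContinuousWithinAt (uncurry H ∘ fun x : E => ((x, t) : E × ℝ)) S x₀ :=
      ContinuousWithinAt.comp (f := fun x : E => ((x, t) : E × ℝ)) (x := x₀)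
        (hH (x₀, t) (mk_mem_prod hx₀ (mem_univ t))) (Continuous.prodMk_left t).continuousWithinAt
        fun x hx => mk_mem_prod hx (mem_univ t)
    exact h2

/-- The sections `x ↦ H x t` have, within `S`, the derivative `∂ₓH (x, t)` wherever `uncurry H` is
differentiable within `S × ℝ`. [cite: Dieudonne1960, (8.11.2)] -/
theorem hasFDerivWithinAt_partialFDerivWithinFst {x : E} {t : ℝ}
    (hd : DifferentiableWithinAt ℝ (uncurry H) (S ×ˢ (univ : Set ℝ)) (x, t)) :
    HasFDerivWithinAt (fun y => H y t) (partialFDerivWithinFst S H x t) S x := by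
  have h2 : HasFDerivWithinAt (fun y : E => ((y, t) : E × ℝ)) (ContinuousLinearMap.inl ℝ E ℝ) S x :=
    ((hasFDerivAt_id x).prodMk (hasFDerivAt_const t x)).hasFDerivWithinAt
  exact hd.hasFDerivWithinAt.comp x h2 fun y hy => mk_mem_prod hy (mem_univ t)

/-- **One derivative under the integral sign, within a locally convex set** (Dieudonné (8.11.2),
one-sided): if `(x, t) ↦ H x t` is `Cⁿ`, `n ≥ 1`, on `S × ℝ` (within), `S` locally convex and of
unique differentiability, then `x ↦ ∫ₐᵇ H x t dt` (`a ≤ b`) has derivative `∫ₐᵇ ∂ₓH (x₀, t) dt` at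
`x₀ ∈ S` within `S` — Folland's dominated differentiation within the convex set `S ∩ B(x₀, ε)`
(`hasFDerivWithinAt_integral_of_dominated_of_fderivWithin_le`) with the constant bound of
`exists_nhdsWithin_prod_uIcc_bound_of_continuousOn` for the continuous `∂ₓH`.
[cite: Dieudonne1960, (8.11.2)] -/
theorem hasFDerivWithinAt_intervalIntegral_within
    (hSc : ∀ x ∈ S, ∃ ε > 0, Convex ℝ (S ∩ ball x ε)) (hSu : UniqueDiffOn ℝ S)
    {n : WithTop ℕ∞} (hH : ContDiffOn ℝ n (uncurry H) (S ×ˢ univ)) (hn : 1 ≤ n) (hab : a ≤ b)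
    {x₀ : E} (hx₀ : x₀ ∈ S) :
    HasFDerivWithinAt (fun x => ∫ t in a..b, H x t)
      (∫ t in a..b, partialFDerivWithinFst S H x₀ t) S x₀ := by
  have hSu' : UniqueDiffOn ℝ (S ×ˢ (univ : Set ℝ)) := hSu.prod uniqueDiffOn_univ
  have hcont : ContinuousOn (uncurry H) (S ×ˢ univ) := hH.continuousOn
  have hn0 : n ≠ 0 := ENat.one_le_iff_ne_zero_withTop.mp hn
  have hcont' : ContinuousOn (uncurry (partialFDerivWithinFst S H)) (S ×ˢ univ) :=
    (hH.continuousOn_fderivWithin hSu' hn).clm_comp continuousOn_const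
  have hder : ∀ x ∈ S, ∀ t : ℝ,
      HasFDerivWithinAt (fun y => H y t) (partialFDerivWithinFst S H x t) S x := fun x hx t =>
    hasFDerivWithinAt_partialFDerivWithinFst (hH.differentiableOn hn0 (x, t) ⟨hx, mem_univ t⟩)
  -- a convex neighbourhood of `x₀` within `S` on which `∂ₓH` is bounded
  obtain ⟨C, s, hs, hC⟩ := exists_nhdsWithin_prod_uIcc_bound_of_continuousOn hcont' hx₀ a b
  obtain ⟨ε₀, hε₀, hconv⟩ := hSc x₀ hx₀
  obtain ⟨ε₁, hε₁, hball⟩ := Metric.mem_nhdsWithin_iff.1 hs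
  have hεpos : 0 < min ε₀ ε₁ := lt_min hε₀ hε₁
  have hS'eq : S ∩ ball x₀ (min ε₀ ε₁) = (S ∩ ball x₀ ε₀) ∩ ball x₀ (min ε₀ ε₁) :=
    Set.ext fun y => ⟨fun ⟨hy, hd⟩ => ⟨⟨hy, mem_ball.2 ((mem_ball.1 hd).trans_le (min_le_left _ _))⟩,
      hd⟩, fun ⟨⟨hy, _⟩, hd⟩ => ⟨hy, hd⟩⟩
  have hS'conv : Convex ℝ (S ∩ ball x₀ (min ε₀ ε₁)) := by
    rw [hS'eq]
    exact hconv.inter (convex_ball x₀ _)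
  have hx₀S' : x₀ ∈ S ∩ ball x₀ (min ε₀ ε₁) := ⟨hx₀, mem_ball_self hεpos⟩
  have hS's : S ∩ ball x₀ (min ε₀ ε₁) ⊆ s := fun y hy =>
    hball ⟨mem_ball.2 ((mem_ball.1 hy.2).trans_le (min_le_right _ _)), hy.1⟩
  have hS'nhds : S ∩ ball x₀ (min ε₀ ε₁) ∈ 𝓝[S] x₀ := inter_mem_nhdsWithin S (ball_mem_nhds x₀ hεpos)
  -- Folland's dominated differentiation within the convex set, for `μ = volume|_(a, b]`
  have key := Literature.Analysis.FunctionSpaces.hasFDerivWithinAt_integral_of_dominated_of_fderivWithin_le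
    (μ := volume.restrict (Ioc a b)) (F := H) (F' := partialFDerivWithinFst S H)
    (bound := fun _ => C) hS'conv hx₀S' hεpos
    (fun x hx => (continuous_section_of_continuousOn_prod_univ hcont hx.1.1).aestronglyMeasurable)
    (((continuous_section_of_continuousOn_prod_univ hcont hx₀).continuousOn.integrableOn_Icc
      (μ := volume) (a := a) (b := b)).mono_set Ioc_subset_Icc_self)
    (continuous_section_of_continuousOn_prod_univ hcont' hx₀).aestronglyMeasurable
    ((ae_restrict_iff' measurableSet_Ioc).2 (Eventually.of_forall fun t ht x hx =>
      hC x (hS's hx.1) t (by rw [uIcc_of_le hab]; exact Ioc_subset_Icc_self ht)))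
    ((continuous_const.continuousOn.integrableOn_Icc (μ := volume) (a := a) (b := b)).mono_set
      Ioc_subset_Icc_self)
    (Eventually.of_forall fun t x hx => (hder x hx.1.1 t).mono inter_subset_left)
  have e : (fun x => ∫ t in a..b, H x t) = fun x => ∫ t in Ioc a b, H x t :=
    funext fun x => integral_of_le hab
  rw [e, integral_of_le hab]
  exact key.2.mono_of_mem_nhdsWithin hS'nhds

end Parametric

/-! ### `Cⁿ` dependence within `S` -/

section ParametricSmooth

variable {E : Type u} [NormedAddCommGroup E] [NormedSpace ℝ E] {S : Set E} {a b : ℝ}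

/-- **`Cᵏ` dependence within `S`, finite orders** (Dieudonné (8.11.2), one-sided, by induction on `k`
through `contDiffOn_succ_iff_fderivWithin`: the derivative within `S` is again such an integral,
`x ↦ ∫ₐᵇ ∂ₓH (x, t) dt`; the value spaces range over `Type (max u v)` so that the induction
hypothesis applies to `E →L[ℝ] G`). [cite: Dieudonne1960, (8.11.2)] -/
theorem contDiffOn_intervalIntegral_within_nat
    (hSc : ∀ x ∈ S, ∃ ε > 0, Convex ℝ (S ∩ ball x ε)) (hSu : UniqueDiffOn ℝ S) (hab : a ≤ b)
    (k : ℕ) :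
    ∀ {G : Type (max u v)} [NormedAddCommGroup G] [NormedSpace ℝ G]
      {H : E → ℝ → G}, ContDiffOn ℝ k (uncurry H) (S ×ˢ univ) →
        ContDiffOn ℝ k (fun x => ∫ t in a..b, H x t) S := by
  have hSu' : UniqueDiffOn ℝ (S ×ˢ (univ : Set ℝ)) := hSu.prod uniqueDiffOn_univ
  induction k with
  | zero =>
    intro G _ _ H hH
    rw [Nat.cast_zero, contDiffOn_zero] at hH ⊢
    exact continuousOn_intervalIntegral_within hH
  | succ k ih =>
    intro G _ _ H hH
    have hH' : ContDiffOn ℝ ((k : WithTop ℕ∞) + 1) (uncurry H) (S ×ˢ univ) := by exact_mod_cast hH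
    have h1 : (1 : WithTop ℕ∞) ≤ (k : WithTop ℕ∞) + 1 := le_add_self
    have hderiv : ∀ x ∈ S, HasFDerivWithinAt (fun x => ∫ t in a..b, H x t)
        (∫ t in a..b, partialFDerivWithinFst S H x t) S x := fun x hx =>
      hasFDerivWithinAt_intervalIntegral_within hSc hSu hH' h1 hab hx
    have hF : ContDiffOn ℝ k (uncurry (partialFDerivWithinFst S H)) (S ×ˢ univ) :=
      (hH'.fderivWithin hSu' le_rfl).clm_comp contDiffOn_const
    rw [Nat.cast_succ, contDiffOn_succ_iff_fderivWithin hSu]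
    refine ⟨fun x hx => (hderiv x hx).differentiableWithinAt,
      fun h => absurd h (by exact_mod_cast WithTop.coe_ne_top), ?_⟩
    exact (ih (H := partialFDerivWithinFst S H) hF).congr fun x hx =>
      (hderiv x hx).fderivWithin (hSu x hx)

/-- **Smooth dependence of interval integrals on a parameter WITHIN a locally convex set of unique
differentiability** (Dieudonné (8.11.2), one-sided): if `(x, t) ↦ H x t` is `Cⁿ` (`n : ℕ∞`) on
`S × ℝ`, then `x ↦ ∫ₐᵇ H x t dt` (`a ≤ b`) is `Cⁿ` on `S` (values in `G : Type (max u v)`,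
`E : Type u`). [cite: Dieudonne1960, (8.11.2)] -/
theorem contDiffOn_intervalIntegral_within {G : Type (max u v)} [NormedAddCommGroup G]
    [NormedSpace ℝ G] {H : E → ℝ → G}
    (hSc : ∀ x ∈ S, ∃ ε > 0, Convex ℝ (S ∩ ball x ε)) (hSu : UniqueDiffOn ℝ S) (hab : a ≤ b)
    {n : ℕ∞} (hH : ContDiffOn ℝ n (uncurry H) (S ×ˢ univ)) :
    ContDiffOn ℝ n (fun x => ∫ t in a..b, H x t) S := by
  induction n with
  | top =>
    exact contDiffOn_infty.2 fun k =>
      contDiffOn_intervalIntegral_within_nat hSc hSu hab k (contDiffOn_infty.1 hH k)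
  | coe k => exact contDiffOn_intervalIntegral_within_nat hSc hSu hab k hH

/-- **Local convexity of `O ∩ K`** for `O` open and `K` convex — the shape of the targets of
extended charts of manifolds with corners (`K = range I`). [cite: Dieudonne1960, (8.11.2)] -/
theorem locallyConvex_inter_of_isOpen_convex {O K : Set E} (hO : IsOpen O) (hK : Convex ℝ K)
    {x : E} (hx : x ∈ O ∩ K) : ∃ ε > 0, Convex ℝ ((O ∩ K) ∩ ball x ε) := by
  obtain ⟨ε, hε, hball⟩ := Metric.isOpen_iff.1 hO x hx.1
  refine ⟨ε, hε, ?_⟩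
  have h : (O ∩ K) ∩ ball x ε = K ∩ ball x ε :=
    Set.ext fun y => ⟨fun ⟨⟨_, hyK⟩, hyb⟩ => ⟨hyK, hyb⟩, fun ⟨hyK, hyb⟩ => ⟨⟨hball hyb, hyK⟩, hyb⟩⟩
  rw [h]
  exact hK.inter (convex_ball x ε)

end ParametricSmooth

end Literature.Analysis.Calculus
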